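import Summits.CriticalPhenomena.PercolationContinuityZ3.Theorems.PercNonProliferationNonProliferationThreeCrosserDecayAboveSix
import Summits.CriticalPhenomena.PercolationContinuityZ3.Theorems.PercNonProliferationNonProliferationOfOneRatioThreeCrossers
import Summits.CriticalPhenomena.PercolationContinuityZ3.Theorems.PercNonProliferationNonProliferationStubSubshellCrossers
import Summits.CriticalPhenomena.PercolationContinuityZ3.Theorems.PercNonProliferationNonProliferationStubDisjointShellsIndep
import Summits.CriticalPhenomena.PercolationContinuityZ3.Theorems.PercNonProliferationNonProliferationStubShellOfBoxCrossers
import Literature.Probability.Percolation.RSW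
import HarnessLib

/-!
# Crux `PercNonProliferation.NonProliferation` (stmt-CriticalPhenomena-4444), line `avoidance-cost-covering` —
# calibration: the one-ratio shell three-crosser criterion fails above six dimensions

Stub `oneRatioThreeCrossersDim_false_above_six` of the skeleton
`Cruxes/NonProliferation/Lines/avoidance_cost_covering.lean`; lands with
`--supports stmt-CriticalPhenomena-4444` and closes nothing.

Write `Sh_d(a, c) := {v ∈ B(c) | ∃ l, a ≤ |v l|}` for the closed shell `a ≤ ‖v‖∞ ≤ c` of `ℤ^d` and
`E₃^d(a, c)` for the event "three points of `B(a)`, each joined INSIDE `Sh_d(a, c)` to `∂ⁱⁿB(c)`, pairwise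
not joined inside `Sh_d(a, c)`". The line reduces the `d = 3` crux to the single open inequality
`stub_oneRatioThreeCrossers`: `∃ k₀ ≥ 2, a₀ ≥ 1, q` with `(k₀+1)² q < 1` and
`P_{p_c(ℤ³)}(E₃(a, k₀ a)) ≤ q` for all `a ≥ a₀`. Its `d`-dimensional analogue replaces `3` by `d` and the
threshold exponent `2` by `d - 1` (the mid-sphere of `ℤ^d` is covered by `≍ k^{d-1}` translates of `B(m)`).

**This file: the analogue is FALSE for every `d > 6` satisfying Aizenman's two-point condition
`TwoPointBoundedRatio d`** — so the open stub is an input that fails in `d ≥ 7`, as the crux's standing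
disproof file (`Negative.nonProliferation_false_without_dimThree`) demands of every proof.

Proof (dimension-free bookkeeping, `d`-specific input only through
`threeCrosserDecayDim_false_above_six`, i.e. the barrier `SpanningClustersAboveSix`):
* `ShellThreeAboveSix.real_shellThree_submult_dim`: for `a ≤ b < b' ≤ c`,
  `P(E₃^d(a,c)) ≤ P(E₃^d(a,b)) · P(E₃^d(b',c))` — a.s. `ω ⊆ E(ℤ^d)` (`ae_subset_edgeSet`), restriction
  to the two sub-shells (`stub_subshellCrossers`, every `d`) and independence of disjoint shells
  (`stub_disjointShellsIndep`, every `d`);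
* the abstract ladder `OneRatioThreeCrossers.ladder_of_submult`:
  `P(E₃^d(a, k₀ (k₀+1)^j a)) ≤ q^{j+1}` for all `j` and `a ≥ a₀`;
* given `η > 0` choose `j` with `k₀^{d-1} q ((k₀+1)^{d-1} q)^j ≤ η` (`exists_pow_lt_of_lt_one`), put
  `k := k₀ (k₀+1)^j ≥ 2`, `m₀ := a₀`; box three-crossers of `B(k m) ∖ B(m)` are shell three-crossers
  a.s. (`stub_shellOfBoxCrossers`, every `d`), so `k^{d-1} P(box event) ≤ k^{d-1} q^{j+1} ≤ η`: this
  is the hypothesis of `threeCrosserDecayDim_false_above_six`, which is contradictory for `d > 6`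
  under (t-c).
-/

noncomputable section

namespace Summit.CriticalPhenomena.PercolationContinuityZ3.Theorems.NonProliferation

open MeasureTheory Filter Topology
open Literature.Probability.LatticeModels Literature.Probability.Percolation
open Literature.Barriers.CriticalPhenomena
open Summit.CriticalPhenomena.PercolationContinuityZ3.Theorems.NonProliferation.Negative

/-- The closed shell `Sh_d(a, c) = {v ∈ B(c) | ∃ l, a ≤ |v l|}` of `ℤ^d` (local notation only). -/
local notation3 "ShD⟦" d ", " a ", " c "⟧" =>
  ({v : Site d | v ∈ box d c ∧ ∃ l : Fin d, ((a : ℕ) : ℤ) ≤ |v l|} : Set (Site d))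

/-- The shell three-crosser event `E₃^d(a, c)` of `ℤ^d` (local notation only). -/
local notation3 "ED₃⟦" d ", " a ", " c "⟧" =>
  ({ω : BondConfig (Site d) | ∃ x : Fin (2 + 1) → Site d, (∀ i, x i ∈ box d a) ∧
    (∀ i, ∃ y ∈ innerBoundary (zdGraph d) (box d c), ω ∈ openConnIn ShD⟦d, a, c⟧ (x i) y) ∧
    ∀ i j, i ≠ j → ω ∉ openConnIn ShD⟦d, a, c⟧ (x i) (x j)} : Set (BondConfig (Site d)))

namespace ShellThreeAboveSix

/-- **Shell submultiplicativity of the three-crosser probability in dimension `d`** (every `p`): for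
`a ≤ b < b' ≤ c`, `P_p(E₃^d(a,c)) ≤ P_p(E₃^d(a,b)) · P_p(E₃^d(b',c))`. Almost every configuration uses
lattice edges only (`ae_subset_edgeSet`); on those, three shell-distinct crossers of `Sh_d(a,c)`
restrict to three of `Sh_d(a,b)` and three of `Sh_d(b',c)` (`stub_subshellCrossers`); the two shell
events are independent (`stub_disjointShellsIndep`, `b < b'`). Copy of the `d = 3` proof
`OneRatioThreeCrossers.real_shellThree_submult` with `3 ↦ d`. -/
theorem real_shellThree_submult_dim (d : ℕ) (p : unitInterval) {a b b' c : ℕ} (hab : a ≤ b)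
    (hbb' : b < b') (hb'c : b' ≤ c) :
    (bondPercolation (zdGraph d) p).real ED₃⟦d, a, c⟧ ≤
      (bondPercolation (zdGraph d) p).real ED₃⟦d, a, b⟧ *
        (bondPercolation (zdGraph d) p).real ED₃⟦d, b', c⟧ := by
  have hincl : ∀ᵐ ω ∂(bondPercolation (zdGraph d) p),
      ω ∈ ED₃⟦d, a, c⟧ → ω ∈ ED₃⟦d, a, b⟧ ∩ ED₃⟦d, b', c⟧ := by
    filter_upwards [ae_subset_edgeSet (zdGraph d) p] with ω hω hmem
    exact stub_subshellCrossers d 2 a b b' c ω hab (by omega) (by omega) hb'c hω hmem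
  calc (bondPercolation (zdGraph d) p).real ED₃⟦d, a, c⟧
      ≤ (bondPercolation (zdGraph d) p).real (ED₃⟦d, a, b⟧ ∩ ED₃⟦d, b', c⟧) := by
        simp only [measureReal_def]
        exact ENNReal.toReal_mono (measure_ne_top _ _) (measure_mono_ae hincl)
    _ ≤ _ := stub_disjointShellsIndep d 2 a b b' c p hbb'

/-- **The ladder for the critical shell three-crosser probability in dimension `d`**: if
`P_{p_c(ℤ^d)}(E₃^d(a, k₀ a)) ≤ q` for all `a ≥ a₀ ≥ 1` (`k₀ ≥ 1`), then
`P_{p_c(ℤ^d)}(E₃^d(a, k₀ (k₀+1)^j a)) ≤ q^{j+1}` for all `j` and `a ≥ a₀`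
(`OneRatioThreeCrossers.ladder_of_submult` with `real_shellThree_submult_dim`). -/
theorem real_shellThree_ladder_dim (d : ℕ) {k₀ a₀ : ℕ} {q : ℝ} (hk₀ : 1 ≤ k₀) (ha₀ : 1 ≤ a₀)
    (hcrit : ∀ a : ℕ, a₀ ≤ a →
      (bondPercolation (zdGraph d) (criticalProbI d)).real ED₃⟦d, a, k₀ * a⟧ ≤ q) :
    ∀ j a : ℕ, a₀ ≤ a →
      (bondPercolation (zdGraph d) (criticalProbI d)).real ED₃⟦d, a, k₀ * (k₀ + 1) ^ j * a⟧ ≤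
        q ^ (j + 1) :=
  OneRatioThreeCrossers.ladder_of_submult
    (P := fun a c => (bondPercolation (zdGraph d) (criticalProbI d)).real ED₃⟦d, a, c⟧)
    (fun _ _ => measureReal_nonneg)
    (fun _ _ _ _ hab hbb' hb'c => real_shellThree_submult_dim d (criticalProbI d) hab hbb' hb'c)
    hk₀ ha₀ hcrit

/-- **Choice of the number of shells.** For `A ≥ 0`, `t < 1` and `η > 0` there is `j` with
`A t^j ≤ η` (`exists_pow_lt_of_lt_one` with `ε = η / (A + 1)`). -/
theorem exists_mul_pow_le {A t η : ℝ} (hA : 0 ≤ A) (ht1 : t < 1) (hη : 0 < η) :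
    ∃ j : ℕ, A * t ^ j ≤ η := by
  obtain ⟨j, hj⟩ := exists_pow_lt_of_lt_one (show (0 : ℝ) < η / (A + 1) by positivity) ht1
  refine ⟨j, ?_⟩
  have h1 : A * t ^ j ≤ A * (η / (A + 1)) := mul_le_mul_of_nonneg_left hj.le hA
  have h2 : A * (η / (A + 1)) ≤ η := by
    rw [mul_div_assoc', div_le_iff₀ (by positivity)]
    nlinarith
  exact h1.trans h2

/-- **Exponent bookkeeping.** `(k₀ (k₀+1)^j)^n q^{j+1} = (k₀^n q) ((k₀+1)^n q)^j`. -/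
theorem ratio_pow_mul_pow (k₀ q : ℝ) (j n : ℕ) :
    (k₀ * (k₀ + 1) ^ j) ^ n * q ^ (j + 1) = k₀ ^ n * q * ((k₀ + 1) ^ n * q) ^ j := by
  rw [mul_pow, ← pow_mul, mul_comm j n, pow_mul]
  ring

end ShellThreeAboveSix

open ShellThreeAboveSix in
/-- **Calibration: the one-ratio shell three-crosser criterion fails above six dimensions.** For every
`d > 6` satisfying Aizenman's two-point condition `TwoPointBoundedRatio d` ((t-c) with `η = 0`) there are
NO `k₀ ≥ 2`, `a₀ ≥ 1`, `q` with `(k₀+1)^{d-1} q < 1` and `P_{p_c(ℤ^d)}(E₃^d(a, k₀ a)) ≤ q` for all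
`a ≥ a₀`: the shell ladder (`real_shellThree_ladder_dim`) and the a.s. inclusion of box three-crossers in
shell three-crossers (`stub_shellOfBoxCrossers`) would give the `d`-dimensional box three-crosser decay
`k^{d-1} P ≤ η` at the ratio `k = k₀ (k₀+1)^j`, which `threeCrosserDecayDim_false_above_six` forbids.
Hence the `d = 3` open stub `stub_oneRatioThreeCrossers` is a genuinely three-dimensional input. -/
theorem oneRatioThreeCrossersDim_false_above_six :
    ∀ (d : ℕ) [NeZero d], 6 < d → Literature.Barriers.CriticalPhenomena.TwoPointBoundedRatio d →
    ¬ ∃ k₀ a₀ : ℕ, ∃ q : ℝ, 2 ≤ k₀ ∧ 1 ≤ a₀ ∧ ((k₀ : ℝ) + 1) ^ (d - 1) * q < 1 ∧ ∀ a : ℕ, a₀ ≤ a →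
      (bondPercolation (zdGraph d) (criticalProbI d)).real
        {ω | ∃ x : Fin (2 + 1) → Site d, (∀ i, x i ∈ box d a) ∧
          (∀ i, ∃ y ∈ innerBoundary (zdGraph d) (box d (k₀ * a)),
            ω ∈ openConnIn {v : Site d | v ∈ box d (k₀ * a) ∧ ∃ l : Fin d, (a : ℤ) ≤ |v l|} (x i) y) ∧
          ∀ i j, i ≠ j →
            ω ∉ openConnIn {v : Site d | v ∈ box d (k₀ * a) ∧ ∃ l : Fin d, (a : ℤ) ≤ |v l|} (x i) (x j)}
        ≤ q := by
  intro d _ hd hτ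
  rintro ⟨k₀, a₀, q, hk₀, ha₀, hθ, hcrit⟩
  refine threeCrosserDecayDim_false_above_six hd hτ fun η hη => ?_
  set μ : Measure (BondConfig (Site d)) := bondPercolation (zdGraph d) (criticalProbI d) with hμ
  have hq0 : 0 ≤ q := le_trans measureReal_nonneg (hcrit a₀ le_rfl)
  have hlad := real_shellThree_ladder_dim d (q := q) (show 1 ≤ k₀ by omega) ha₀ hcrit
  -- the base `t = (k₀+1)^{d-1} q < 1`, the constant `A = k₀^{d-1} q ≥ 0`, the number of shells `j`
  set t : ℝ := ((k₀ : ℝ) + 1) ^ (d - 1) * q with ht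
  set A : ℝ := (k₀ : ℝ) ^ (d - 1) * q with hA
  have hA0 : 0 ≤ A := by positivity
  obtain ⟨j, hjA⟩ := exists_mul_pow_le hA0 hθ hη
  -- the ratio `k = k₀ (k₀+1)^j ≥ 2`, the threshold `m₀ = a₀`
  have hK : 1 ≤ (k₀ + 1) ^ j := Nat.one_le_pow _ _ (by omega)
  have hk2 : 2 ≤ k₀ * (k₀ + 1) ^ j :=
    calc 2 ≤ k₀ := hk₀
      _ = k₀ * 1 := (mul_one _).symm
      _ ≤ k₀ * (k₀ + 1) ^ j := Nat.mul_le_mul_left _ hK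
  refine ⟨k₀ * (k₀ + 1) ^ j, hk2, a₀, fun m hm => ?_⟩
  have hmL : m ≤ k₀ * (k₀ + 1) ^ j * m :=
    Nat.le_mul_of_pos_left m (Nat.mul_pos (by omega) (by positivity))
  -- box three-crossers are shell three-crossers (a.e.), then the ladder
  have hincl : ∀ᵐ ω ∂μ,
      ω ∈ {ω | ∃ x : Fin (2 + 1) → Site d, (∀ i, x i ∈ box d m) ∧
        (∀ i, ∃ y ∈ innerBoundary (zdGraph d) (box d (k₀ * (k₀ + 1) ^ j * m)),
          ω ∈ openConnIn (↑(box d (k₀ * (k₀ + 1) ^ j * m)) : Set (Site d)) (x i) y) ∧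
        ∀ i j', i ≠ j' →
          ω ∉ openConnIn (↑(box d (k₀ * (k₀ + 1) ^ j * m)) : Set (Site d)) (x i) (x j')} →
      ω ∈ ED₃⟦d, m, k₀ * (k₀ + 1) ^ j * m⟧ := by
    filter_upwards [ae_subset_edgeSet (zdGraph d) (criticalProbI d)] with ω hω hmem
    exact stub_shellOfBoxCrossers d 2 m _ ω hmL hω hmem
  have hbox : μ.real {ω | ∃ x : Fin (2 + 1) → Site d, (∀ i, x i ∈ box d m) ∧
        (∀ i, ∃ y ∈ innerBoundary (zdGraph d) (box d (k₀ * (k₀ + 1) ^ j * m)),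
          ω ∈ openConnIn (↑(box d (k₀ * (k₀ + 1) ^ j * m)) : Set (Site d)) (x i) y) ∧
        ∀ i j', i ≠ j' →
          ω ∉ openConnIn (↑(box d (k₀ * (k₀ + 1) ^ j * m)) : Set (Site d)) (x i) (x j')}
      ≤ q ^ (j + 1) := by
    calc _ ≤ μ.real ED₃⟦d, m, k₀ * (k₀ + 1) ^ j * m⟧ := by
          simp only [measureReal_def]
          exact ENNReal.toReal_mono (measure_ne_top _ _) (measure_mono_ae hincl)
      _ ≤ q ^ (j + 1) := hlad j m hm
  -- arithmetic: (k₀ (k₀+1)^j)^{d-1} q^{j+1} = A t^j ≤ η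
  have hcast : ((k₀ * (k₀ + 1) ^ j : ℕ) : ℝ) = (k₀ : ℝ) * ((k₀ : ℝ) + 1) ^ j := by push_cast; ring
  have halg : ((k₀ : ℝ) * ((k₀ : ℝ) + 1) ^ j) ^ (d - 1) * q ^ (j + 1) = A * t ^ j := by
    rw [hA, ht]
    exact ratio_pow_mul_pow (k₀ : ℝ) q j (d - 1)
  calc ((k₀ * (k₀ + 1) ^ j : ℕ) : ℝ) ^ (d - 1) * μ.real _
      ≤ ((k₀ * (k₀ + 1) ^ j : ℕ) : ℝ) ^ (d - 1) * q ^ (j + 1) := by gcongr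
    _ = ((k₀ : ℝ) * ((k₀ : ℝ) + 1) ^ j) ^ (d - 1) * q ^ (j + 1) := by rw [hcast]
    _ = A * t ^ j := halg
    _ ≤ η := hjA

end Summit.CriticalPhenomena.PercolationContinuityZ3.Theorems.NonProliferation

end
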